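import Literature.NumberTheory.LFunctions.KadiriFarZeroTail
import HarnessLib

/-!
# Splittings — Robin finite lens: the TAIL INPUT `Σ_{|Im ρ| > T} m(ρ)/(Im ρ)² ≤ (log(T/2π) + 1)/(πT) + (184 + 30 log T)/T²`
# PROVED unconditionally (kernel, RH-free) from the tree's explicit zero count (SPLIT-robin-finite gen 6; zero-def raw form)

Cell rh-split, seat rh-split-robin-finite g6 (brief sha16 f79c5f09d8bcb036), card `run/shared/lean/pub/rh-split/cards/SPLIT-robin-finite.md`
§13; zero-definition raw form of `HOME/rh-split-robin-finite/SketchG6-Tail.lean` (sha16 00806b33b3847ae4; referee rh-split-ref g3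
2026-08-27T04:13:52Z: DELIVERABLE, farm rc 0 / 0 warn / 0 sorry, std axioms on `zeroTailBound_tailH`, `zeroTailBound_PT`,
`nicolasLowerBetween_PT_tailFree`; CONTENT REPLAY PASS for a zero-def carve), filed by rh-split-typer-1 g4 (lead ORDER 04:17:26Z).
The scratch's interface defs `ZeroTailBound T h` (`Σ_{|Im ρ|>T} m(ρ)/(Im ρ)² ≤ h`, all non-trivial zeros, with multiplicity, no
hypothesis on real parts), `lehmanH`, `lehmanTail`, `tailH` are SPELLED OUT VERBATIM at every site; proofs are the scratch's with the
`unfold` steps of the spelled-out abbreviations removed; `zeroTailBound_mono` (= `le_trans`) inlined; the scratch's `summable_tailTerm'`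
(T ≥ 7) is not carried — the tree's `RobinFiniteE1c.summable_tailTerm` (every `T`, p494053) is the same statement.
HONEST LABEL: «SPLITTING SEARCH over kernel-typed RH-EQUIVALENCES; a splitting A ∧ B ⟹ RH is CONDITIONAL bookkeeping
unless A and B are both proved; nothing here bears on the truth of RH.»

The seat's g3 interface `ZeroTailBound T h : Σ_{|Im ρ| > T} m(ρ)/(Im ρ)² ≤ h` was fed by the named-fact candidate `lehmanTail` (Lehman's
lemma, Brent–Platt–Trudgian 2021 L.1 [corpus:paper:arxiv-2009.13791 p3 L35–51]); the tree's `RobinFiniteE1c.nicolasLowerBetween_PT` (p494053)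
takes the bound at `T = 3 000 175 332 800` as its ONE input about the unverified zeros.  Here the bound with
`tailH T = (log(T/2π) + 1)/(πT) + (184 + 30 log T)/T²` (Lehman's main term; cruder `T⁻²` constants) is PROVED for every `T ≥ 7`
(`zeroTailBound_tailH`) from the tree's explicit zero count (`SchoenfeldZeroSums`: `N⁻ ≤ N ≤ N⁺` for `t ≥ 7`; error `≤ 44 + 7.2 log t`,
`countErr_le`) by partial summation (`sum_zerosBetween_le_of_count_le`, Rosser–Schoenfeld 1975 L.7) with `φ(t) = t⁻²` against the smooth
majorant (`count_le_smooth`), an exact antiderivative (`oneSided_sum_le`, `endpoint_alg`), reflection `ρ ↦ ρ̄` (`sum_sdiff_zerosUpTo_eq_two_mul`)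
and finite sums → `tsum` (`Real.tsum_le_of_sum_le`; `sum_tailTerm_le`).  Certified numerics: `tailH(3 000 175 332 800) ≤ 2.961·10⁻¹²`
(`tailH_PT_le`, `zeroTailBound_PT`; Lehman `2.96·10⁻¹²`), `tailH(10⁵) ≤ 3.42·10⁻⁵` (`tailH_1e5_le`, `zeroTailBound_1e5`); `lehmanH ≤ tailH`.
RH-free; imports ONLY `Literature.NumberTheory.LFunctions.KadiriFarZeroTail`.  Part (B) = `RobinFiniteTailFree.lean`.  Card §13 (referee-confirmed):
«lehmanTail, print-only» is STRUCK from the conditional headline's modulo-list — the tail input is a kernel theorem.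
-/

set_option linter.dupNamespace false

noncomputable section

open Complex Filter Set MeasureTheory Topology intervalIntegral Finset
open scoped Real ComplexConjugate

namespace Summit.RiemannHypothesis.RiemannHypothesis.Theorems.Splittings.RobinFiniteTail

open Literature.NumberTheory.LFunctions
open Literature.NumberTheory.LFunctions.SchoenfeldBound
open Literature.NumberTheory.LFunctions.NicolasJExplicit

/-! ### The explicit tail value versus Lehman's -/

/-- `lehmanH T ≤ tailH T` (scratch names; both spelled out): Lehman's tail value `(log(T/2π) + 1)/(πT) + 0.56(0.5 + 2 log T)/T²`
(BPT 2021 L.1, `A = 0.28`, `φ = t⁻²`) is below the value proved here — same main term, larger `T⁻²` constants — for `T ≥ 1`. -/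
theorem lehmanH_le_tailH {T : ℝ} (hT : 1 ≤ T) :
    (Real.log (T / (2 * π)) + 1) / (π * T) + 0.56 * (0.5 + 2 * Real.log T) / T ^ 2 ≤
      (Real.log (T / (2 * π)) + 1) / (π * T) + (184 + 30 * Real.log T) / T ^ 2 := by
  have hl : 0 ≤ Real.log T := Real.log_nonneg hT
  have h : 0.56 * (0.5 + 2 * Real.log T) / T ^ 2 ≤ (184 + 30 * Real.log T) / T ^ 2 :=
    div_le_div_of_nonneg_right (by nlinarith) (by positivity)
  linarith

/-! ### The explicit zero count: error term, endpoint algebra (`p` = `π`, `lT`/`lU`/`l₂` = logs), one-sided sum between two heights -/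

/-- the error in `N⁺`, `N⁻` is `≤ 44 + 7.2 log t` for `t ≥ 7`
(`2K/(πt) ≤ 0.06`, `Σ(t) ≤ 38 + 7.2 log(t+5) ≤ 43 + 7.2 log t`). -/
theorem countErr_le {t : ℝ} (ht : 7 ≤ t) :
    2 * stirlingVertRate (1 / 4) / (π * t) + argBound t ≤ 44 + 7.2 * Real.log t := by
  have hK := stirlingVertRate_quarter_lt
  have hK0 : 0 ≤ stirlingVertRate (1 / 4) := by unfold stirlingVertRate; positivity
  have hπ := Real.pi_pos
  have hπ3 := Real.pi_gt_three
  have hs : 2 * stirlingVertRate (1 / 4) / (π * t) ≤ 0.06 := by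
    rw [div_le_iff₀ (by positivity)]; nlinarith
  have harg : argBound t ≤ 38 + 7.2 * Real.log (t + 5) := by
    have := KadiriTail.argBound_le (u := t - 1) (by linarith)
    rw [show t - 1 + 1 = t by ring, show t - 1 + 6 = t + 5 by ring] at this
    exact this
  have hlog : Real.log (t + 5) ≤ 0.6931471808 + Real.log t := by
    have h2t : Real.log (t + 5) ≤ Real.log (2 * t) := Real.log_le_log (by linarith) (by linarith)
    rw [Real.log_mul (by norm_num) (by linarith)] at h2t
    have := Real.log_two_lt_d9
    linarith
  have hlt : 0 ≤ Real.log t := Real.log_nonneg (by linarith)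
  linarith

/-- smooth explicit MAJORANT of `N(t)`, `t ≥ 7`:
`N(t) ≤ t/(2π)(log t − log 2π) − t/(2π) + 7/8 + (44 + 7.2 log t)`. -/
theorem count_le_smooth {t : ℝ} (ht : 7 ≤ t) :
    (zetaZeroCount t : ℝ) ≤
      t / (2 * π) * (Real.log t - Real.log (2 * π)) - t / (2 * π) + 7 / 8 + (44 + 7.2 * Real.log t) := by
  have h := zetaZeroCount_le_countUpper ht
  have he := countErr_le ht
  have ht0 : 0 < t := by linarith
  unfold countUpper countMain at h
  rw [Real.log_div ht0.ne' (by positivity)] at h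
  linarith

/-- smooth explicit MINORANT of `N(t)`, `t ≥ 7`. -/
theorem smooth_le_count {t : ℝ} (ht : 7 ≤ t) :
    t / (2 * π) * (Real.log t - Real.log (2 * π)) - t / (2 * π) + 7 / 8 - (44 + 7.2 * Real.log t) ≤
      (zetaZeroCount t : ℝ) := by
  have h := countLower_le_zetaZeroCount ht
  have he := countErr_le ht
  have ht0 : 0 < t := by linarith
  unfold countLower countMain at h
  rw [Real.log_div ht0.ne' (by positivity)] at h
  linarith

/-- after partial summation and the exact antiderivative, the bound collapses to
`(lT − l₂ + 1)/(2pT) + (92 + 15 lT)/T²`:  the `U`-end is `≤ 0` and the `T`-end uses `c = N(T) ≥ N⁻(T)`. -/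
theorem endpoint_alg {p T U c lT lU l₂ : ℝ} (hp : 3 < p) (hT : 7 ≤ T) (hTU : T ≤ U)
    (hlU : l₂ ≤ lU) (hlT : 0 ≤ lT)
    (hc : T / (2 * p) * (lT - l₂) - T / (2 * p) + 7 / 8 - (44 + 7.2 * lT) ≤ c) :
    (U / (2 * p) * (lU - l₂) - U / (2 * p) + 7 / 8 + (44 + 7.2 * lU) - c) * (U ^ 2)⁻¹ +
        ((-(lU - l₂) / (p * U) + (c - 48.475 - 7.2 * lU) / U ^ 2) -
          (-(lT - l₂) / (p * T) + (c - 48.475 - 7.2 * lT) / T ^ 2))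
      ≤ (lT - l₂ + 1) / (2 * p * T) + (92 + 15 * lT) / T ^ 2 := by
  have hp0 : 0 < p := by linarith
  have hT0 : 0 < T := by linarith
  have hU0 : 0 < U := by linarith
  rw [← sub_nonneg]
  have key : (lT - l₂ + 1) / (2 * p * T) + (92 + 15 * lT) / T ^ 2 -
      ((U / (2 * p) * (lU - l₂) - U / (2 * p) + 7 / 8 + (44 + 7.2 * lU) - c) * (U ^ 2)⁻¹ +
        ((-(lU - l₂) / (p * U) + (c - 48.475 - 7.2 * lU) / U ^ 2) -
          (-(lT - l₂) / (p * T) + (c - 48.475 - 7.2 * lT) / T ^ 2)))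
      = (0.4 + 0.6 * lT + (c - (T / (2 * p) * (lT - l₂) - T / (2 * p) + 7 / 8 - (44 + 7.2 * lT)))) / T ^ 2
        + (lU - l₂ + 1) / (2 * p * U) + 3.6 / U ^ 2 := by
    field_simp
    ring
  rw [key]
  have h1 : 0 ≤ (0.4 + 0.6 * lT + (c - (T / (2 * p) * (lT - l₂) - T / (2 * p) + 7 / 8 - (44 + 7.2 * lT)))) /
      T ^ 2 := div_nonneg (by linarith) (by positivity)
  have h2 : 0 ≤ (lU - l₂ + 1) / (2 * p * U) := div_nonneg (by linarith) (by positivity)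
  have h3 : (0 : ℝ) ≤ 3.6 / U ^ 2 := by positivity
  linarith

/-- **One-sided explicit Lehman-type bound**: for `7 ≤ T ≤ U`,
`Σ_{T < Im ρ ≤ U} m(ρ)/(Im ρ)² ≤ (log T − log 2π + 1)/(2πT) + (92 + 15 log T)/T²`
(partial summation against `N`, smooth majorant, exact antiderivative, `N(T) ≥ N⁻(T)`). -/
theorem oneSided_sum_le {T U : ℝ} (hT : 7 ≤ T) (hTU : T ≤ U) :
    ∑ ρ ∈ zerosBetween T U, (riemannZetaZeroOrder ρ : ℝ) * (ρ.im ^ 2)⁻¹ ≤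
      (Real.log T - Real.log (2 * π) + 1) / (2 * π * T) + (92 + 15 * Real.log T) / T ^ 2 := by
  have hπ := Real.pi_pos
  have hT0 : 0 < T := by linarith
  have hU0 : 0 < U := by linarith
  -- Step 1: partial summation with `f(t) = t⁻²` against the smooth majorant
  have hf : ∀ t ∈ Icc T U, HasDerivAt (fun t : ℝ => (t ^ 2)⁻¹) (-2 / t ^ 3) t := by
    intro t ht
    have ht0 : 0 < t := hT0.trans_le ht.1
    have h1 : HasDerivAt (fun x : ℝ => x ^ 2) (2 * t) t := by simpa using hasDerivAt_pow 2 t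
    refine (h1.inv (by positivity)).congr_deriv ?_
    field_simp
  have hf' : ContinuousOn (fun t : ℝ => -2 / t ^ 3) (Icc T U) := by
    refine fun t ht => ContinuousAt.continuousWithinAt ?_
    have ht3 : t ^ 3 ≠ 0 := pow_ne_zero 3 (hT0.trans_le ht.1).ne'
    fun_prop (disch := assumption)
  have hf'0 : ∀ t ∈ Icc T U, -2 / t ^ 3 ≤ (0 : ℝ) := by
    intro t ht
    have ht0 : 0 < t := hT0.trans_le ht.1
    rw [neg_div]
    exact neg_nonpos.2 (by positivity)
  have hfT : (0 : ℝ) ≤ (U ^ 2)⁻¹ := by positivity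
  have hN : ∀ t ∈ Icc T U, (zetaZeroCount t : ℝ) ≤
      t / (2 * π) * (Real.log t - Real.log (2 * π)) - t / (2 * π) + 7 / 8 + (44 + 7.2 * Real.log t) :=
    fun t ht => count_le_smooth (hT.trans ht.1)
  have hNc : ContinuousOn (fun t : ℝ =>
      t / (2 * π) * (Real.log t - Real.log (2 * π)) - t / (2 * π) + 7 / 8 + (44 + 7.2 * Real.log t))
      (Icc T U) := by
    refine fun t ht => ContinuousAt.continuousWithinAt ?_
    have ht0 : t ≠ 0 := (hT0.trans_le ht.1).ne'
    fun_prop (disch := assumption)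
  have step1 := sum_zerosBetween_le_of_count_le hT0.le hTU hf hf' hf'0 hfT hN hNc
  have hlow := smooth_le_count hT
  -- the unknown integer `N(T)` becomes a free real `c`
  generalize hc : (zetaZeroCount T : ℝ) = c at step1 hlow
  -- Step 2: the integral, exactly, by the fundamental theorem of calculus
  have hG : ∀ t ∈ uIcc T U, HasDerivAt
      (fun t : ℝ => -(Real.log t - Real.log (2 * π)) / (π * t) + (c - 48.475 - 7.2 * Real.log t) / t ^ 2)
      ((t / (2 * π) * (Real.log t - Real.log (2 * π)) - t / (2 * π) + 7 / 8 + (44 + 7.2 * Real.log t) - c) *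
        -(-2 / t ^ 3)) t := by
    intro t ht
    rw [uIcc_of_le hTU] at ht
    have ht0 : 0 < t := hT0.trans_le ht.1
    have hl : HasDerivAt Real.log t⁻¹ t := Real.hasDerivAt_log ht0.ne'
    have hA : HasDerivAt (fun t : ℝ => -(Real.log t - Real.log (2 * π)) / (π * t))
        ((-t⁻¹ * (π * t) - -(Real.log t - Real.log (2 * π)) * π) / (π * t) ^ 2) t := by
      refine HasDerivAt.div (hl.sub_const _).neg ?_ (by positivity)
      simpa using (hasDerivAt_id t).const_mul π
    have hB : HasDerivAt (fun t : ℝ => (c - 48.475 - 7.2 * Real.log t) / t ^ 2)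
        ((-(7.2 * t⁻¹) * t ^ 2 - (c - 48.475 - 7.2 * Real.log t) * (2 * t)) / (t ^ 2) ^ 2) t := by
      refine HasDerivAt.div ((hl.const_mul 7.2).const_sub (c - 48.475)) ?_ (by positivity)
      simpa using hasDerivAt_pow 2 t
    refine (hA.add hB).congr_deriv ?_
    field_simp
    ring
  have hint : IntervalIntegrable (fun t : ℝ =>
      (t / (2 * π) * (Real.log t - Real.log (2 * π)) - t / (2 * π) + 7 / 8 + (44 + 7.2 * Real.log t) - c) *
        -(-2 / t ^ 3)) volume T U :=
    ((hNc.sub continuousOn_const).mul hf'.neg).intervalIntegrable_of_Icc hTU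
  have step2 := integral_eq_sub_of_hasDerivAt hG hint
  rw [step2] at step1
  -- Step 3: the endpoint algebra
  have hlU : Real.log (2 * π) ≤ Real.log U := by
    refine Real.log_le_log (by positivity) ?_
    linarith [Real.pi_lt_d2]
  have hlT : 0 ≤ Real.log T := Real.log_nonneg (by linarith)
  exact step1.trans (endpoint_alg Real.pi_gt_three hT hTU hlU hlT hlow)

/-- Every finite partial sum of the tail series is `≤ tailH T` (spelled out; `T ≥ 7`):
reflection `ρ ↦ ρ̄` (`m(ρ̄) = m(ρ)`, `(Im ρ̄)² = (Im ρ)²`) + the one-sided bound up to a height above the finite set. -/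
theorem sum_tailTerm_le {T : ℝ} (hT : 7 ≤ T) (s : Finset RHWave0.riemannZetaNontrivialZeros) :
    ∑ ρ ∈ s, (if T < |(ρ : ℂ).im| then (riemannZetaZeroOrder (ρ : ℂ) : ℝ) / (ρ : ℂ).im ^ 2 else 0) ≤
      (Real.log (T / (2 * π)) + 1) / (π * T) + (184 + 30 * Real.log T) / T ^ 2 := by
  classical
  have hπ := Real.pi_pos
  have h0 : (0 : ℝ) ≤ T := by linarith
  have hT0 : 0 < T := by linarith
  -- a height above every zero of `s`
  set U : ℝ := T + ∑ ρ ∈ s, |(ρ : ℂ).im| with hU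
  have hTU : T ≤ U := by
    rw [hU]; linarith [Finset.sum_nonneg (fun ρ (_ : ρ ∈ s) => abs_nonneg ((ρ : ℂ).im))]
  have hle : ∀ ρ ∈ s, |(ρ : ℂ).im| ≤ U := fun ρ hρ => by
    rw [hU]
    have := Finset.single_le_sum (fun ρ' (_ : ρ' ∈ s) => abs_nonneg ((ρ' : ℂ).im)) hρ
    linarith
  have h1 : ∑ ρ ∈ s, (if T < |(ρ : ℂ).im| then (riemannZetaZeroOrder (ρ : ℂ) : ℝ) / (ρ : ℂ).im ^ 2 else 0) ≤
      ∑ ρ ∈ zerosUpTo U \ zerosUpTo T, (riemannZetaZeroOrder (ρ : ℂ) : ℝ) / (ρ : ℂ).im ^ 2 := by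
    rw [← Finset.sum_filter]
    refine Finset.sum_le_sum_of_subset_of_nonneg (fun ρ hρ => ?_) fun ρ _ _ =>
      div_nonneg (zeroOrder_nonneg' ρ) (sq_nonneg _)
    rw [Finset.mem_filter] at hρ
    rw [Finset.mem_sdiff, mem_zerosUpTo, mem_zerosUpTo, not_le]
    exact ⟨hle ρ hρ.1, hρ.2⟩
  have h2 := sum_sdiff_zerosUpTo_eq_two_mul h0 (T₂ := U)
    (g := fun z => (riemannZetaZeroOrder z : ℝ) / z.im ^ 2)
    (fun z => by simp only [riemannZetaZeroOrder_conj_holds z, Complex.conj_im, neg_sq])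
  have h3 : ∑ ρ ∈ zerosBetween T U, (riemannZetaZeroOrder ρ : ℝ) / ρ.im ^ 2 ≤
      (Real.log T - Real.log (2 * π) + 1) / (2 * π * T) + (92 + 15 * Real.log T) / T ^ 2 := by
    simpa only [div_eq_mul_inv] using oneSided_sum_le hT hTU
  have h4 : 2 * ((Real.log T - Real.log (2 * π) + 1) / (2 * π * T) + (92 + 15 * Real.log T) / T ^ 2) =
      (Real.log (T / (2 * π)) + 1) / (π * T) + (184 + 30 * Real.log T) / T ^ 2 := by
    rw [Real.log_div hT0.ne' (by positivity)]
    field_simp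
    ring
  calc ∑ ρ ∈ s, (if T < |(ρ : ℂ).im| then (riemannZetaZeroOrder (ρ : ℂ) : ℝ) / (ρ : ℂ).im ^ 2 else 0)
      ≤ ∑ ρ ∈ zerosUpTo U \ zerosUpTo T, (riemannZetaZeroOrder (ρ : ℂ) : ℝ) / (ρ : ℂ).im ^ 2 := h1
    _ = 2 * ∑ ρ ∈ zerosBetween T U, (riemannZetaZeroOrder ρ : ℝ) / ρ.im ^ 2 := h2
    _ ≤ 2 * ((Real.log T - Real.log (2 * π) + 1) / (2 * π * T) + (92 + 15 * Real.log T) / T ^ 2) :=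
        mul_le_mul_of_nonneg_left h3 (by norm_num)
    _ = (Real.log (T / (2 * π)) + 1) / (π * T) + (184 + 30 * Real.log T) / T ^ 2 := h4

/-! ### HEADLINE: the tail input is a theorem -/

/-- **The tail input, PROVED for every `T ≥ 7`** (RH-free, from the tree's explicit `N(t)`; scratch `zeroTailBound_tailH :
ZeroTailBound T (tailH T)`, both spelled out): `Σ_{|Im ρ| > T} m(ρ)/(Im ρ)² ≤ (log(T/2π) + 1)/(πT) + (184 + 30 log T)/T²`, the sum over
ALL non-trivial zeros with multiplicity (a genuine bound: every finite partial sum is bounded, `Real.tsum_le_of_sum_le`). -/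
theorem zeroTailBound_tailH {T : ℝ} (hT : 7 ≤ T) :
    ∑' ρ : RHWave0.riemannZetaNontrivialZeros,
        (if T < |(ρ : ℂ).im| then (riemannZetaZeroOrder (ρ : ℂ) : ℝ) / (ρ : ℂ).im ^ 2 else 0) ≤
      (Real.log (T / (2 * π)) + 1) / (π * T) + (184 + 30 * Real.log T) / T ^ 2 := by
  have hnn : 0 ≤ fun ρ : RHWave0.riemannZetaNontrivialZeros =>
      (if T < |(ρ : ℂ).im| then (riemannZetaZeroOrder (ρ : ℂ) : ℝ) / (ρ : ℂ).im ^ 2 else 0) := by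
    intro ρ
    simp only [Pi.zero_apply]
    split_ifs
    · exact div_nonneg (zeroOrder_nonneg' ρ) (sq_nonneg _)
    · exact le_rfl
  exact Real.tsum_le_of_sum_le hnn fun s => sum_tailTerm_le hT s

/-- The `lehmanTail`-shaped statement of the scratch (`∀ T ≥ 2πe, ZeroTailBound T (· T)`) with `tailH` in place of `lehmanH`
(`2πe ≥ 7`), PROVED; spelled out. -/
theorem tailInput_holds : ∀ T : ℝ, 2 * π * rexp 1 ≤ T →
    ∑' ρ : RHWave0.riemannZetaNontrivialZeros,
        (if T < |(ρ : ℂ).im| then (riemannZetaZeroOrder (ρ : ℂ) : ℝ) / (ρ : ℂ).im ^ 2 else 0) ≤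
      (Real.log (T / (2 * π)) + 1) / (π * T) + (184 + 30 * Real.log T) / T ^ 2 := by
  intro T hT
  refine zeroTailBound_tailH ?_
  have h := mul_le_mul (le_of_lt Real.pi_gt_three) (le_of_lt Real.exp_one_gt_d9) (by norm_num)
    Real.pi_pos.le
  nlinarith

/-! ### Certified numerics at the two heights the card uses; the PROVED tail inputs at `H₀` and `10⁵` -/

/-- `exp 26.9 ≥ 4.78·10¹¹` (`e ≥ 2.7182818283`, `exp 0.009 ≥ 1.009`). -/
theorem exp_269_ge : (4.78e11 : ℝ) ≤ Real.exp 26.9 := by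
  have h1 : Real.exp 1 ^ 26 * Real.exp 0.009 ^ 100 = Real.exp 26.9 := by
    rw [← Real.exp_nat_mul, ← Real.exp_nat_mul, ← Real.exp_add]
    norm_num
  have h2 : (2.7182818283 : ℝ) ^ 26 ≤ Real.exp 1 ^ 26 :=
    pow_le_pow_left₀ (by norm_num) Real.exp_one_gt_d9.le 26
  have h3 : (1.009 : ℝ) ^ 100 ≤ Real.exp 0.009 ^ 100 := by
    refine pow_le_pow_left₀ (by norm_num) ?_ 100
    have := Real.add_one_le_exp (0.009 : ℝ)
    norm_num at this ⊢
    exact this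
  rw [← h1]
  calc (4.78e11 : ℝ) ≤ 2.7182818283 ^ 26 * 1.009 ^ 100 := by norm_num
    _ ≤ Real.exp 1 ^ 26 * Real.exp 0.009 ^ 100 := mul_le_mul h2 h3 (by positivity) (by positivity)

/-- `exp 29 ≥ 3.1·10¹²`. -/
theorem exp_29_ge : (3.1e12 : ℝ) ≤ Real.exp 29 := by
  have h1 : Real.exp 1 ^ 29 = Real.exp 29 := by
    rw [← Real.exp_nat_mul]; norm_num
  have h2 : (2.7182818283 : ℝ) ^ 29 ≤ Real.exp 1 ^ 29 :=
    pow_le_pow_left₀ (by norm_num) Real.exp_one_gt_d9.le 29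
  rw [← h1]
  exact le_trans (by norm_num) h2

/-- **`tailH(3 000 175 332 800) ≤ 2.961·10⁻¹²`** (spelled out; Lehman's value at the Platt–Trudgian height is `2.96·10⁻¹²`): the
proved tail costs nothing at `H₀`. -/
theorem tailH_PT_le :
    (Real.log (3000175332800 / (2 * π)) + 1) / (π * 3000175332800) + (184 + 30 * Real.log 3000175332800) / 3000175332800 ^ 2 ≤ 2.961e-12 := by
  have hπ := Real.pi_gt_d6
  have hπ' := Real.pi_pos
  have hq : (3000175332800 : ℝ) / (2 * π) ≤ 4.78e11 := by
    rw [div_le_iff₀ (by positivity)]; nlinarith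
  have hL : Real.log (3000175332800 / (2 * π)) ≤ 26.9 := by
    rw [Real.log_le_iff_le_exp (by positivity)]
    exact hq.trans exp_269_ge
  have hlT : Real.log (3000175332800 : ℝ) ≤ 29 := by
    rw [Real.log_le_iff_le_exp (by positivity)]
    exact le_trans (by norm_num) exp_29_ge
  have hlT0 : 0 ≤ Real.log (3000175332800 : ℝ) := Real.log_nonneg (by norm_num)
  have h1 : (Real.log (3000175332800 / (2 * π)) + 1) / (π * 3000175332800) ≤
      27.9 / (3.141592 * 3000175332800) :=
    div_le_div₀ (by norm_num) (by linarith) (by positivity) (by nlinarith)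
  have h2 : (184 + 30 * Real.log (3000175332800 : ℝ)) / (3000175332800 : ℝ) ^ 2 ≤
      1054 / (3000175332800 : ℝ) ^ 2 :=
    div_le_div_of_nonneg_right (by linarith) (by positivity)
  have h3 : (27.9 : ℝ) / (3.141592 * 3000175332800) + 1054 / (3000175332800 : ℝ) ^ 2 ≤ 2.961e-12 := by
    norm_num
  linarith

/-- `exp 9.7 ≥ 15920` and `exp 11.52 ≥ 100000`. -/
theorem exp_97_ge : (15920 : ℝ) ≤ Real.exp 9.7 ∧ (100000 : ℝ) ≤ Real.exp 11.52 := by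
  have he := Real.exp_one_gt_d9.le
  constructor
  · have h1 : Real.exp 1 ^ 9 * Real.exp 0.007 ^ 100 = Real.exp 9.7 := by
      rw [← Real.exp_nat_mul, ← Real.exp_nat_mul, ← Real.exp_add]
      norm_num
    have h2 : (2.7182818283 : ℝ) ^ 9 ≤ Real.exp 1 ^ 9 := pow_le_pow_left₀ (by norm_num) he 9
    have h3 : (1.007 : ℝ) ^ 100 ≤ Real.exp 0.007 ^ 100 := by
      refine pow_le_pow_left₀ (by norm_num) ?_ 100
      have := Real.add_one_le_exp (0.007 : ℝ)
      norm_num at this ⊢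
      exact this
    rw [← h1]
    calc (15920 : ℝ) ≤ 2.7182818283 ^ 9 * 1.007 ^ 100 := by norm_num
      _ ≤ Real.exp 1 ^ 9 * Real.exp 0.007 ^ 100 := mul_le_mul h2 h3 (by positivity) (by positivity)
  · have h1 : Real.exp 1 ^ 11 * Real.exp 0.0052 ^ 100 = Real.exp 11.52 := by
      rw [← Real.exp_nat_mul, ← Real.exp_nat_mul, ← Real.exp_add]
      norm_num
    have h2 : (2.7182818283 : ℝ) ^ 11 ≤ Real.exp 1 ^ 11 := pow_le_pow_left₀ (by norm_num) he 11
    have h3 : (1.0052 : ℝ) ^ 100 ≤ Real.exp 0.0052 ^ 100 := by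
      refine pow_le_pow_left₀ (by norm_num) ?_ 100
      have := Real.add_one_le_exp (0.0052 : ℝ)
      norm_num at this ⊢
      exact this
    rw [← h1]
    calc (100000 : ℝ) ≤ 2.7182818283 ^ 11 * 1.0052 ^ 100 := by norm_num
      _ ≤ Real.exp 1 ^ 11 * Real.exp 0.0052 ^ 100 := mul_le_mul h2 h3 (by positivity) (by positivity)

/-- **`tailH(10⁵) ≤ 3.42·10⁻⁵`** (spelled out; Lehman: `3.40·10⁻⁵`) — the kernel-height row of the card. -/
theorem tailH_1e5_le :
    (Real.log (100000 / (2 * π)) + 1) / (π * 100000) + (184 + 30 * Real.log 100000) / 100000 ^ 2 ≤ 3.42e-5 := by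
  have hπ := Real.pi_gt_d6
  have hπ' := Real.pi_pos
  obtain ⟨he1, he2⟩ := exp_97_ge
  have hq : (100000 : ℝ) / (2 * π) ≤ 15920 := by
    rw [div_le_iff₀ (by positivity)]; nlinarith
  have hL : Real.log (100000 / (2 * π)) ≤ 9.7 := by
    rw [Real.log_le_iff_le_exp (by positivity)]
    exact hq.trans he1
  have hlT : Real.log (100000 : ℝ) ≤ 11.52 := by
    rw [Real.log_le_iff_le_exp (by positivity)]
    exact he2
  have hlT0 : 0 ≤ Real.log (100000 : ℝ) := Real.log_nonneg (by norm_num)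
  have h1 : (Real.log (100000 / (2 * π)) + 1) / (π * 100000) ≤ 10.7 / (3.141592 * 100000) :=
    div_le_div₀ (by norm_num) (by linarith) (by positivity) (by nlinarith)
  have h2 : (184 + 30 * Real.log (100000 : ℝ)) / (100000 : ℝ) ^ 2 ≤ 529.6 / (100000 : ℝ) ^ 2 :=
    div_le_div_of_nonneg_right (by linarith) (by positivity)
  have h3 : (10.7 : ℝ) / (3.141592 * 100000) + 529.6 / (100000 : ℝ) ^ 2 ≤ 3.42e-5 := by norm_num
  linarith

/-- **The Platt–Trudgian-height tail input of g5's headline, PROVED** (scratch `zeroTailBound_PT : ZeroTailBound 3000175332800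
(2.961·10⁻¹²)`, spelled out): `Σ_{|Im ρ| > 3 000 175 332 800} m(ρ)/(Im ρ)² ≤ 2.961·10⁻¹²`.  The tree's
`RobinFiniteE1c.nicolasLowerBetween_PT` consumes exactly this (see `RobinFiniteTailFree`). -/
theorem zeroTailBound_PT :
    ∑' ρ : RHWave0.riemannZetaNontrivialZeros,
        (if 3000175332800 < |(ρ : ℂ).im| then (riemannZetaZeroOrder (ρ : ℂ) : ℝ) / (ρ : ℂ).im ^ 2 else 0) ≤
      2.961e-12 :=
  le_trans (zeroTailBound_tailH (by norm_num)) tailH_PT_le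

/-- The kernel-height tail input, PROVED: `Σ_{|Im ρ| > 10⁵} m(ρ)/(Im ρ)² ≤ 3.42·10⁻⁵` (scratch `zeroTailBound_1e5`, spelled out). -/
theorem zeroTailBound_1e5 :
    ∑' ρ : RHWave0.riemannZetaNontrivialZeros,
        (if 100000 < |(ρ : ℂ).im| then (riemannZetaZeroOrder (ρ : ℂ) : ℝ) / (ρ : ℂ).im ^ 2 else 0) ≤
      3.42e-5 :=
  le_trans (zeroTailBound_tailH (by norm_num)) tailH_1e5_le

end Summit.RiemannHypothesis.RiemannHypothesis.Theorems.Splittings.RobinFiniteTail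

end
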